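import Mathlib
import Summits.CriticalPhenomena.Ising3DConformalLimit.Theorems.MarkovRigidityFieldRealisation
import Literature.Probability.LatticeModels.FieldScalingLimitPlusBoxProofs
import Literature.Probability.LatticeModels.ScalingLimit3D
import Literature.Probability.LatticeModels.CriticalScalingDimension
import Literature.Probability.LatticeModels.CriticalTwoPointBounds
import Literature.Probability.LatticeModels.PlusMinusStateGibbs
import Literature.MathematicalPhysics.QuantumLattice.EuclideanAction
import HarnessLib

/-!
# `BallSpecification.BallSpecifiedFieldLimit` — stub `stub_fieldLimitOfEuclidean` (item stmt-CriticalPhenomena-11247), proved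

THEOREM-ONLY file (lead c3, line `registered`, `Cruxes/BallSpecifiedFieldLimit/Lines/birth.lean`): the
registered open conjecture crit-ising.S03 `CritIsing3DEuclideanLimit` (POINTWISE Euclidean-invariant,
scale-covariant, non-degenerate scaling limit `S` of `criticalCorr 3` under `ρ`) already yields the FIELD
limit, conjuncts C1–C12 of the crux, plus the moment data the Markov nodes consume. Steps: (1) normalise
`S` off `NonCoincident`; (2) window `1/2 ≤ Δ ≤ 1` (`scalingDimension_mem_Icc_holds`), critical DLR state
`ν` (`exists_plusMeasure_holds`), and `MarkovRigidityFieldRealisation.exists_limitLaw` — for ANY boxes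
with `δ·L(δ) → ∞` the `ν`-smeared fields converge in law to the Minlos measure `μ` of the moment series;
(3) boxes `L(δ) = 2(H₀(δ) + ⌊δ⁻²⌋ + ⌈|ρ(δ)|/δ²⌉)` with `⟨σ₀⟩⁺_{box H₀(δ);β_c} ≤ δ²/(1+|ρ(δ)|)`, possible
since `⟨σ₀⟩⁺_{box H;β_c} ↓ m*(β_c) = 0` on `ℤ³`; then the renormalised plus-boundary magnetisation
functional vanishes (`tendsto_plusBoundaryMagnetization_of_center`) and the finite-volume `+` laws have
the same limit in law (`norm_genFunctional_isingFieldLaw_sub_spinFieldLaw_le`, FKG–Lipschitz);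
(4) Euclidean invariance of the law by `map_act_eq_self` and a change of variables.
References: Glimm–Jaffe 1987 §6.1; Friedli–Velenik 2017 Lemma 3.22, Lemma 6.65;
Aizenman–Duminil-Copin–Sidoravicius 2015 Thm 1.2; Duminil-Copin ICM 2022 §8.4. No definitions.
-/

noncomputable section

namespace Summit.CriticalPhenomena.Ising3DConformalLimit.Theorems

open MeasureTheory Filter Complex Literature.Probability.LatticeModels
  Literature.MathematicalPhysics.QuantumLattice
open Summit.CriticalPhenomena.Ising3DConformalLimit.MarkovRigidityFieldRealisation
open scoped Topology ENNReal SchwartzMap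

/-! ### Normalisation off the non-coincident configurations -/

section Normalise

variable {d : ℕ}

/-- Injective maps preserve non-coincidence of configurations (both ways). [folklore] -/
theorem fieldLimit_comp_mem_nonCoincident_iff {n : ℕ} {φ : EuclideanSpace ℝ (Fin d) → EuclideanSpace ℝ (Fin d)}
    (hφ : Function.Injective φ) (x : Fin n → EuclideanSpace ℝ (Fin d)) :
    (fun i => φ (x i)) ∈ NonCoincident d n ↔ x ∈ NonCoincident d n := by
  simp only [mem_nonCoincident]
  exact ⟨fun h i j hij => h (by simp only [hij]), fun h => hφ.comp h⟩

/-- Normalisation does not change a pointwise scaling limit (locally uniform convergence is tested on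
`NonCoincident` only). [folklore] -/
theorem fieldLimit_hasPointwiseScalingLimit_indicator {G : LatticeCorrFamily d} {ρ : ℝ → ℝ}
    {S : CorrFamily d} (h : HasPointwiseScalingLimit G ρ S) :
    HasPointwiseScalingLimit G ρ (fun n => (NonCoincident d n).indicator (S n)) :=
  fun n => (h n).congr_right fun _ hz => (Set.indicator_of_mem hz _).symm

/-- Normalisation does not change non-degeneracy. [folklore] -/
theorem fieldLimit_isNondegenerateTwoPoint_indicator {S : CorrFamily d} (h : IsNondegenerateTwoPoint S) :
    IsNondegenerateTwoPoint (fun n => (NonCoincident d n).indicator (S n)) := by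
  intro x hx
  simp only [Set.indicator_of_mem hx]
  exact h x hx

/-- Normalisation does not change Euclidean invariance (isometries are injective). [folklore] -/
theorem fieldLimit_isEuclideanInvariant_indicator {S : CorrFamily d} (h : IsEuclideanInvariant S) :
    IsEuclideanInvariant (fun n => (NonCoincident d n).indicator (S n)) := by
  refine ⟨fun n v x => ?_, fun n R x => ?_⟩
  · have hφ : Function.Injective fun p : EuclideanSpace ℝ (Fin d) => p + v := add_left_injective v
    by_cases hx : x ∈ NonCoincident d n
    · have hx' : (fun i => x i + v) ∈ NonCoincident d n := (fieldLimit_comp_mem_nonCoincident_iff hφ x).2 hx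
      simp only [Set.indicator_of_mem hx, Set.indicator_of_mem hx']
      exact h.1 n v x
    · have hx' : (fun i => x i + v) ∉ NonCoincident d n :=
        fun h' => hx ((fieldLimit_comp_mem_nonCoincident_iff hφ x).1 h')
      simp only [Set.indicator_of_notMem hx, Set.indicator_of_notMem hx']
  · by_cases hx : x ∈ NonCoincident d n
    · have hx' : (fun i => R (x i)) ∈ NonCoincident d n :=
        (fieldLimit_comp_mem_nonCoincident_iff R.injective x).2 hx
      simp only [Set.indicator_of_mem hx, Set.indicator_of_mem hx']
      exact h.2 n R x
    · have hx' : (fun i => R (x i)) ∉ NonCoincident d n :=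
        fun h' => hx ((fieldLimit_comp_mem_nonCoincident_iff R.injective x).1 h')
      simp only [Set.indicator_of_notMem hx, Set.indicator_of_notMem hx']

/-- Normalisation does not change scale covariance (dilations by `c > 0` are injective). [folklore] -/
theorem fieldLimit_isScaleCovariant_indicator {Δ : ℝ} {S : CorrFamily d} (h : IsScaleCovariant Δ S) :
    IsScaleCovariant Δ (fun n => (NonCoincident d n).indicator (S n)) := by
  intro n c hc x
  have hφ : Function.Injective fun p : EuclideanSpace ℝ (Fin d) => c • p := smul_right_injective _ hc.ne'
  by_cases hx : x ∈ NonCoincident d n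
  · have hx' : (fun i => c • x i) ∈ NonCoincident d n := (fieldLimit_comp_mem_nonCoincident_iff hφ x).2 hx
    simp only [Set.indicator_of_mem hx, Set.indicator_of_mem hx']
    exact h n c hc x
  · have hx' : (fun i => c • x i) ∉ NonCoincident d n :=
      fun h' => hx ((fieldLimit_comp_mem_nonCoincident_iff hφ x).1 h')
    simp only [Set.indicator_of_notMem hx, Set.indicator_of_notMem hx', mul_zero]

/-- A function continuous on an open set, extended by zero, is Borel measurable. [folklore] -/
theorem fieldLimit_measurable_indicator_of_continuousOn {X : Type*} [TopologicalSpace X]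
    [MeasurableSpace X] [OpensMeasurableSpace X] {s : Set X} (hs : IsOpen s) {f : X → ℝ}
    (hf : ContinuousOn f s) : Measurable (s.indicator f) := by
  refine measurable_of_isOpen fun O hO => ?_
  by_cases h0 : (0 : ℝ) ∈ O
  · have hpre : s.indicator f ⁻¹' O = (s ∩ f ⁻¹' O) ∪ sᶜ := by
      ext x
      by_cases hx : x ∈ s
      · simp [hx]
      · simp [hx, h0]
    rw [hpre]
    exact (hf.isOpen_inter_preimage hs hO).measurableSet.union hs.measurableSet.compl
  · have hpre : s.indicator f ⁻¹' O = s ∩ f ⁻¹' O := by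
      ext x
      by_cases hx : x ∈ s
      · simp [hx]
      · simp [hx, h0]
    rw [hpre]
    exact (hf.isOpen_inter_preimage hs hO).measurableSet

end Normalise

/-! ### The boxes: the plus boundary condition is invisible at the smearing scale -/

section Boxes

/-- `⟨σ₀⟩⁺_{box H; β_c, 0} → m*(β_c) = 0` on `ℤ³` (box limit of the plus one-point function,
`tendsto_isingCorr_plus_box`, and continuity of the magnetisation at `β_c` for `d = 3`,
`spontaneousMagnetization_criticalBeta_eq_zero_holds`). [cite: AizenmanDuminilCopinSidoraviciusCMP2015, Thm. 1.2] -/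
theorem fieldLimit_tendsto_plusCenter_zero :
    Tendsto (fun H : ℕ => isingExpect (zdGraph 3) (box 3 H) (criticalBeta 3) 0 .plus (spinAt 0))
      atTop (𝓝 0) := by
  have hs : spinProduct ({0} : Finset (Site 3)) = spinAt 0 := by funext s; simp [spinProduct]
  have h := tendsto_isingCorr_plus_box (d := 3) (criticalBeta_nonneg 3) 0 {0}
  have hlim : plusCorr 3 (criticalBeta 3) 0 {0} = 0 := by
    rw [plusCorr, hs]
    exact spontaneousMagnetization_criticalBeta_eq_zero_holds (d := 3) le_rfl
  simp only [isingCorr, hs, hlim] at h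
  exact h

/-- The plus one-point function at the centre is nonincreasing in the box (FKG volume monotonicity,
Friedli–Velenik 2017, Lemma 3.22). [cite: FriedliVelenik2017, Lemma 3.22] -/
theorem fieldLimit_plusCenter_antitone :
    Antitone fun H : ℕ => isingExpect (zdGraph 3) (box 3 H) (criticalBeta 3) 0 .plus (spinAt 0) :=
  fun _ _ h => isingExpect_plus_anti_volume_of_fkg (zdGraph 3) (ising_fkg_holds _) (criticalBeta_nonneg 3) 0
    (box_mono 3 h) (spinAt_mono 0) (measurable_spinAt 0)

/-- **Choice of the boxes.** For every renormalisation `ρ` there are box sides `L(δ)` with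
`δ·L(δ) → ∞`, `ρ(δ)·⟨σ₀⟩⁺_{box ⌊L(δ)/2⌋; β_c} → 0` and `ρ(δ)/(δ L(δ)) → 0` as `δ → 0⁺`:
`L(δ) = 2 (H₀(δ) + ⌊δ⁻²⌋ + ⌈|ρ(δ)|/δ²⌉)` with `⟨σ₀⟩⁺_{box H₀(δ)} ≤ δ²/(1 + |ρ(δ)|)`. [folklore] -/
theorem fieldLimit_exists_boxes (ρ : ℝ → ℝ) :
    ∃ L : ℝ → ℕ, Tendsto (fun δ : ℝ => δ * L δ) (𝓝[>] 0) atTop ∧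
      Tendsto (fun δ : ℝ => ρ δ *
        isingExpect (zdGraph 3) (box 3 (L δ / 2)) (criticalBeta 3) 0 .plus (spinAt 0)) (𝓝[>] 0) (𝓝 0) ∧
      Tendsto (fun δ : ℝ => ρ δ / (δ * L δ) ^ 1) (𝓝[>] 0) (𝓝 0) := by
  set a : ℕ → ℝ := fun H => isingExpect (zdGraph 3) (box 3 H) (criticalBeta 3) 0 .plus (spinAt 0) with ha
  have ha0 : ∀ H, 0 ≤ a H := fun H =>
    isingExpect_plus_spinAt_nonneg (criticalBeta_nonneg 3) (zero_mem_box 3 H)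
  have hat : Tendsto a atTop (𝓝 0) := fieldLimit_tendsto_plusCenter_zero
  have hanti : Antitone a := fieldLimit_plusCenter_antitone
  -- the inner box side `H₀ δ`
  have hex : ∀ δ : ℝ, ∃ H : ℕ, 0 < δ → a H ≤ δ ^ 2 / (1 + |ρ δ|) := by
    intro δ
    by_cases hδ : 0 < δ
    · have ht : 0 < δ ^ 2 / (1 + |ρ δ|) := by positivity
      obtain ⟨H, hH⟩ := (hat.eventually (eventually_lt_nhds ht)).exists
      exact ⟨H, fun _ => hH.le⟩
    · exact ⟨0, fun h => absurd h hδ⟩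
  choose H₀ hH₀ using hex
  refine ⟨fun δ => 2 * (H₀ δ + ⌊δ⁻¹ ^ 2⌋₊ + ⌈|ρ δ| / δ ^ 2⌉₊), ?_, ?_, ?_⟩
  · -- `δ L(δ) ≥ δ ⌊δ⁻²⌋ → ∞`
    refine tendsto_atTop_mono' _ ?_ tendsto_mesh_mul_boxSide
    filter_upwards [self_mem_nhdsWithin] with δ (hδ : 0 < δ)
    have h1 : (⌊δ⁻¹ ^ 2⌋₊ : ℝ) ≤ ((2 * (H₀ δ + ⌊δ⁻¹ ^ 2⌋₊ + ⌈|ρ δ| / δ ^ 2⌉₊) : ℕ) : ℝ) := by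
      exact_mod_cast (by omega : ⌊δ⁻¹ ^ 2⌋₊ ≤ 2 * (H₀ δ + ⌊δ⁻¹ ^ 2⌋₊ + ⌈|ρ δ| / δ ^ 2⌉₊))
    exact mul_le_mul_of_nonneg_left h1 hδ.le
  · -- `|ρ δ · a (L δ / 2)| ≤ δ²`
    have hsq : Tendsto (fun δ : ℝ => δ ^ 2) (𝓝[>] 0) (𝓝 0) := by
      have h : Tendsto (fun δ : ℝ => δ ^ 2) (𝓝 0) (𝓝 (0 ^ 2)) := (continuous_pow 2).tendsto 0
      rw [zero_pow two_ne_zero] at h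
      exact h.mono_left nhdsWithin_le_nhds
    refine squeeze_zero_norm' ?_ hsq
    filter_upwards [self_mem_nhdsWithin] with δ (hδ : 0 < δ)
    have hdiv : 2 * (H₀ δ + ⌊δ⁻¹ ^ 2⌋₊ + ⌈|ρ δ| / δ ^ 2⌉₊) / 2 = H₀ δ + ⌊δ⁻¹ ^ 2⌋₊ + ⌈|ρ δ| / δ ^ 2⌉₊ :=
      Nat.mul_div_cancel_left _ two_pos
    have hle : a (2 * (H₀ δ + ⌊δ⁻¹ ^ 2⌋₊ + ⌈|ρ δ| / δ ^ 2⌉₊) / 2) ≤ δ ^ 2 / (1 + |ρ δ|) := by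
      rw [hdiv]
      exact (hanti (by omega : H₀ δ ≤ H₀ δ + ⌊δ⁻¹ ^ 2⌋₊ + ⌈|ρ δ| / δ ^ 2⌉₊)).trans (hH₀ δ hδ)
    have hpos : 0 < 1 + |ρ δ| := by positivity
    rw [Real.norm_eq_abs, abs_mul, abs_of_nonneg (ha0 _)]
    calc |ρ δ| * a (2 * (H₀ δ + ⌊δ⁻¹ ^ 2⌋₊ + ⌈|ρ δ| / δ ^ 2⌉₊) / 2)
        ≤ |ρ δ| * (δ ^ 2 / (1 + |ρ δ|)) := mul_le_mul_of_nonneg_left hle (abs_nonneg _)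
      _ = δ ^ 2 * (|ρ δ| / (1 + |ρ δ|)) := by ring
      _ ≤ δ ^ 2 * 1 := by
          refine mul_le_mul_of_nonneg_left ?_ (by positivity)
          rw [div_le_one hpos]
          linarith [abs_nonneg (ρ δ)]
      _ = δ ^ 2 := mul_one _
  · -- `|ρ δ / (δ L δ)| ≤ δ / 2`
    have hlin : Tendsto (fun δ : ℝ => δ / 2) (𝓝[>] 0) (𝓝 0) := by
      have h : Tendsto (fun δ : ℝ => δ / 2) (𝓝 0) (𝓝 (0 / 2)) := tendsto_id.div_const 2
      rw [zero_div] at h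
      exact h.mono_left nhdsWithin_le_nhds
    refine squeeze_zero_norm' ?_ hlin
    filter_upwards [self_mem_nhdsWithin] with δ (hδ : 0 < δ)
    rw [pow_one, Real.norm_eq_abs]
    by_cases hρ : ρ δ = 0
    · rw [hρ, zero_div, abs_zero]; positivity
    · have hρpos : 0 < |ρ δ| := abs_pos.2 hρ
      have hceil : |ρ δ| / δ ^ 2 ≤ (⌈|ρ δ| / δ ^ 2⌉₊ : ℝ) := Nat.le_ceil _
      have hL : 2 * (|ρ δ| / δ ^ 2) ≤ ((2 * (H₀ δ + ⌊δ⁻¹ ^ 2⌋₊ + ⌈|ρ δ| / δ ^ 2⌉₊) : ℕ) : ℝ) := by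
        push_cast
        nlinarith [(Nat.cast_nonneg (H₀ δ) : (0:ℝ) ≤ H₀ δ), (Nat.cast_nonneg ⌊δ⁻¹ ^ 2⌋₊ : (0:ℝ) ≤ ⌊δ⁻¹ ^ 2⌋₊)]
      have hden : 2 * |ρ δ| / δ ≤ δ * ((2 * (H₀ δ + ⌊δ⁻¹ ^ 2⌋₊ + ⌈|ρ δ| / δ ^ 2⌉₊) : ℕ) : ℝ) := by
        have h' := mul_le_mul_of_nonneg_left hL hδ.le
        calc 2 * |ρ δ| / δ = δ * (2 * (|ρ δ| / δ ^ 2)) := by field_simp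
          _ ≤ _ := h'
      have hdenpos : 0 < 2 * |ρ δ| / δ := by positivity
      rw [abs_div, abs_of_pos (hdenpos.trans_le hden)]
      calc |ρ δ| / (δ * ((2 * (H₀ δ + ⌊δ⁻¹ ^ 2⌋₊ + ⌈|ρ δ| / δ ^ 2⌉₊) : ℕ) : ℝ))
          ≤ |ρ δ| / (2 * |ρ δ| / δ) := div_le_div_of_nonneg_left (abs_nonneg _) hdenpos hden
        _ = δ / 2 := by field_simp

end Boxes

/-! ### Euclidean invariance of the law -/

section Euclid

variable {S : CorrFamily 3} {μ : Measure (FieldConfig (EuclideanSpace ℝ (Fin 3)))}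

/-- A Euclidean motion of `ℝ³` preserves Lebesgue measure. [folklore] -/
theorem fieldLimit_measurePreserving_affineIsometryEquiv
    (g : EuclideanSpace ℝ (Fin 3) ≃ᵃⁱ[ℝ] EuclideanSpace ℝ (Fin 3)) :
    MeasurePreserving (g : EuclideanSpace ℝ (Fin 3) → EuclideanSpace ℝ (Fin 3)) := by
  have hdec : (g : EuclideanSpace ℝ (Fin 3) → EuclideanSpace ℝ (Fin 3)) =
      (fun y => y + g 0) ∘ (g.linearIsometryEquiv : EuclideanSpace ℝ (Fin 3) → EuclideanSpace ℝ (Fin 3)) := by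
    funext y
    have h := g.map_vadd 0 y
    simp only [vadd_eq_add, add_zero] at h
    simpa [Function.comp] using h
  rw [hdec]
  exact (measurePreserving_add_right volume (g 0)).comp g.linearIsometryEquiv.measurePreserving

/-- A Euclidean-invariant family is invariant under every Euclidean motion applied to all points.
[folklore] -/
theorem fieldLimit_apply_affineIsometryEquiv (hE : IsEuclideanInvariant S)
    (g : EuclideanSpace ℝ (Fin 3) ≃ᵃⁱ[ℝ] EuclideanSpace ℝ (Fin 3)) {n : ℕ}
    (y : Fin n → EuclideanSpace ℝ (Fin 3)) : S n (fun i => g (y i)) = S n y := by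
  have hdec : ∀ p, g p = g.linearIsometryEquiv p + g 0 := fun p => by
    have h := g.map_vadd 0 p
    simp only [vadd_eq_add, add_zero] at h
    exact h
  have hfun : (fun i => g (y i)) = fun i => g.linearIsometryEquiv (y i) + g 0 :=
    funext fun i => hdec (y i)
  rw [hfun, hE.1 n (g 0) (fun i => g.linearIsometryEquiv (y i)), hE.2 n g.linearIsometryEquiv y]

/-- The Euclidean motions preserve the smeared moments of a Euclidean-invariant family (change of
variables `x = g ∘ y`). [cite: GlimmJaffe1987, §6.1] -/
theorem fieldLimit_moments_euclid (hE : IsEuclideanInvariant S)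
    (g : EuclideanSpace ℝ (Fin 3) ≃ᵃⁱ[ℝ] EuclideanSpace ℝ (Fin 3)) (n : ℕ)
    (f : SchwartzMap (EuclideanSpace ℝ (Fin 3)) ℝ) :
    ∫ x : Fin n → EuclideanSpace ℝ (Fin 3), (∏ i, (euclidActTest g f) (x i)) * S n x =
      ∫ x : Fin n → EuclideanSpace ℝ (Fin 3), (∏ i, f (x i)) * S n x := by
  simp only [euclidActTest_apply]
  set e : (Fin n → EuclideanSpace ℝ (Fin 3)) ≃ᵐ (Fin n → EuclideanSpace ℝ (Fin 3)) :=
    MeasurableEquiv.piCongrRight fun _ => g.symm.toHomeomorph.toMeasurableEquiv with hedef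
  have he : ∀ x, e x = fun i => g.symm (x i) := fun x => rfl
  have hmp : MeasurePreserving e :=
    volume_preserving_pi fun _ : Fin n => fieldLimit_measurePreserving_affineIsometryEquiv g.symm
  have h := hmp.integral_comp' (fun y : Fin n → EuclideanSpace ℝ (Fin 3) =>
    (∏ i, f (y i)) * S n (fun i => g (y i)))
  simp only [he, AffineIsometryEquiv.apply_symm_apply] at h
  rw [h]
  congr 1
  funext y
  rw [fieldLimit_apply_affineIsometryEquiv hE g y]

/-- **Euclidean invariance of the law** whose generating functional is the moment series of a
Euclidean-invariant family. [cite: GlimmJaffe1987, §6.1] -/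
theorem fieldLimit_isEuclideanInvariantLaw_of [IsProbabilityMeasure μ]
    (hμC : ∀ f : SchwartzMap (EuclideanSpace ℝ (Fin 3)) ℝ, genFunctional μ f =
      ∑' n : ℕ, I ^ n * ((∫ x : Fin n → EuclideanSpace ℝ (Fin 3),
        (∏ i, f (x i)) * S n x : ℝ) : ℂ) / (Nat.factorial n))
    (hE : IsEuclideanInvariant S) : IsEuclideanInvariantLaw μ := by
  intro g
  exact map_act_eq_self hμC (euclidActTest g.symm) fun n f => fieldLimit_moments_euclid hE g.symm n f

end Euclid

/-! ### The stub -/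

/-- **Registered stub `stub_fieldLimitOfEuclidean` (GLUE), proved: the registered open conjecture
crit-ising.S03 `CritIsing3DEuclideanLimit` yields the FIELD scaling limit of the crux (conjuncts
C1–C12) together with `IsProbabilityMeasure μ`, all moments, exponential moments, Borel measurability
of the point functions and a mesh-free kernel bound `|S₂| ≤ C·max(1, ‖x₀−x₁‖^{-a})`, `0 < a < 3`.**
Normalisation off `NonCoincident`; `MarkovRigidityFieldRealisation.exists_limitLaw` (Minlos measure of
the moment series, limit in law of the `ν`-smeared fields); boxes chosen so that the plus boundary is
invisible (`m*(β_c) = 0`, `tendsto_plusBoundaryMagnetization_of_center`,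
`norm_genFunctional_isingFieldLaw_sub_spinFieldLaw_le`); Euclidean invariance and scale covariance of
the law by `map_act_eq_self`. [cite: GlimmJaffe1987, §6.1] -/
theorem stub_fieldLimitOfEuclidean :
    Literature.Probability.LatticeModels.CritIsing3DEuclideanLimit →
    ∃ (ρ : ℝ → ℝ) (Δ : ℝ) (S : Literature.Probability.LatticeModels.CorrFamily 3) (L : ℝ → ℕ)
      (μ : MeasureTheory.Measure (Literature.MathematicalPhysics.QuantumLattice.FieldConfig (EuclideanSpace ℝ (Fin 3)))),
      ((∀ δ ∈ Set.Ioc (0:ℝ) 1, 0 < ρ δ) ∧ 0 < Δ ∧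
      Literature.Probability.LatticeModels.HasPointwiseScalingLimit (Literature.Probability.LatticeModels.criticalCorr 3) ρ S ∧
      (∀ n z, z ∉ Literature.Probability.LatticeModels.NonCoincident 3 n → S n z = 0) ∧
      Literature.Probability.LatticeModels.IsNondegenerateTwoPoint S ∧
      Literature.Probability.LatticeModels.IsEuclideanInvariant S ∧
      Literature.Probability.LatticeModels.IsScaleCovariant Δ S ∧
      Filter.Tendsto (fun δ : ℝ => δ * L δ) (nhdsWithin 0 (Set.Ioi 0)) Filter.atTop ∧
      Literature.MathematicalPhysics.QuantumLattice.TendstoInLaw (fun δ => Literature.MathematicalPhysics.QuantumLattice.spinFieldLaw (Literature.Probability.LatticeModels.isingMeasure (Literature.Probability.LatticeModels.zdGraph 3) (Literature.Probability.LatticeModels.box 3 (L δ)) (Literature.Probability.LatticeModels.criticalBeta 3) 0 Literature.Probability.LatticeModels.BoundaryCondition.plus) (Literature.Probability.LatticeModels.box 3 (L δ)) δ (ρ δ)) (nhdsWithin 0 (Set.Ioi 0)) μ ∧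
      Literature.MathematicalPhysics.QuantumLattice.HasMomentDensity μ S ∧
      Literature.MathematicalPhysics.QuantumLattice.IsEuclideanInvariantLaw μ ∧
      (∀ (s : ℝ) (hs : 0 < s), MeasureTheory.Measure.map (Literature.MathematicalPhysics.QuantumLattice.FieldConfig.act ((s ^ (Δ - 3)) • Literature.MathematicalPhysics.QuantumLattice.dilateTest s hs.ne')) μ = μ)) ∧
      MeasureTheory.IsProbabilityMeasure μ ∧
      Literature.MathematicalPhysics.QuantumLattice.HasAllMoments μ ∧
      (∀ f : SchwartzMap (EuclideanSpace ℝ (Fin 3)) ℝ, MeasureTheory.Integrable (fun ω : Literature.MathematicalPhysics.QuantumLattice.FieldConfig (EuclideanSpace ℝ (Fin 3)) => Real.exp (ω f)) μ) ∧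
      (∀ n, Measurable (S n)) ∧
      (∃ C a : ℝ, 0 < a ∧ a < 3 ∧ ∀ x ∈ Literature.Probability.LatticeModels.NonCoincident 3 2,
        |S 2 x| ≤ C * max 1 (‖x 0 - x 1‖ ^ (-a))) := by
  rintro ⟨ρ, Δ, S, hρ, hΔ, hlim, hnd, hE, hsc⟩
  -- 1. normalise off `NonCoincident`
  set S' : CorrFamily 3 := fun n => (NonCoincident 3 n).indicator (S n) with hS'
  have hlim' : HasPointwiseScalingLimit (criticalCorr 3) ρ S' :=
    fieldLimit_hasPointwiseScalingLimit_indicator hlim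
  have hnorm' : ∀ n z, z ∉ NonCoincident 3 n → S' n z = 0 := fun n z hz => Set.indicator_of_notMem hz _
  have hnd' : IsNondegenerateTwoPoint S' := fieldLimit_isNondegenerateTwoPoint_indicator hnd
  have hE' : IsEuclideanInvariant S' := fieldLimit_isEuclideanInvariant_indicator hE
  have hsc' : IsScaleCovariant Δ S' := fieldLimit_isScaleCovariant_indicator hsc
  -- 2. window, critical DLR state, boxes, continuum law
  obtain ⟨hΔlo, hΔhi⟩ := scalingDimension_mem_Icc_holds ρ Δ S' hlim' hsc' hnd' hρ
  have hΔ32 : Δ < 3 / 2 := by linarith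
  obtain ⟨ν, hνG, -, hν⟩ := exists_plusMeasure_holds (d := 3) (β := criticalBeta 3) (h := 0)
    (criticalBeta_nonneg 3)
  haveI : IsProbabilityMeasure ν := ((mem_isingGibbsMeasures_iff 3 _ 0 ν).1 hνG).isProbabilityMeasure
  obtain ⟨L, hL, hcenter, hfar⟩ := fieldLimit_exists_boxes ρ
  obtain ⟨μ, hμP, hμC, hlawν⟩ := exists_limitLaw (L := L) hlim' hnd' hsc' hΔ hΔ32 hν hL
  haveI := hμP
  -- 3. transfer of the limit in law to the finite-volume `+` boxes
  have hM : ∀ f : SchwartzMap (EuclideanSpace ℝ (Fin 3)) ℝ, Tendsto (fun δ : ℝ =>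
      ∑ x ∈ box 3 (L δ), |ρ δ * δ ^ 3 * f (δ • siteToE x)| *
        isingExpect (zdGraph 3) (box 3 (L δ)) (criticalBeta 3) 0 .plus (spinAt x)) (𝓝[>] 0) (𝓝 0) :=
    fun f => tendsto_plusBoundaryMagnetization_of_center (d := 3) (β := fun _ => criticalBeta 3)
      (fun _ _ => criticalBeta_nonneg 3) hL hcenter ⟨1, hfar⟩ f
  have hlaw : TendstoInLaw (fun δ => isingFieldLaw 3 (criticalBeta 3) L δ ρ) (𝓝[>] 0) μ := by
    intro f
    have hdiff : Tendsto (fun δ => genFunctional (isingFieldLaw 3 (criticalBeta 3) L δ ρ) f -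
        genFunctional (spinFieldLaw ν (box 3 (L δ)) δ (ρ δ)) f) (𝓝[>] 0) (𝓝 0) := by
      rw [tendsto_zero_iff_norm_tendsto_zero]
      have h2 : Tendsto (fun δ : ℝ => 2 * ∑ x ∈ box 3 (L δ), |ρ δ * δ ^ 3 * f (δ • siteToE x)| *
          isingExpect (zdGraph 3) (box 3 (L δ)) (criticalBeta 3) 0 .plus (spinAt x)) (𝓝[>] 0) (𝓝 0) := by
        have h := (hM f).const_mul 2
        rwa [mul_zero] at h
      refine squeeze_zero' (Eventually.of_forall fun δ => norm_nonneg _) (Eventually.of_forall fun δ => ?_) h2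
      exact norm_genFunctional_isingFieldLaw_sub_spinFieldLaw_le (d := 3) le_rfl (criticalBeta_nonneg 3)
        le_rfl hνG L δ ρ f
    have h := (hlawν f).add hdiff
    simp only [add_zero, add_sub_cancel] at h
    exact h
  -- 4. the kernel bound, with a positive exponent
  obtain ⟨a, C, ha0, ha3, hC0, hK⟩ := limit_two_le_kernel hlim' hnd' hsc' hΔ hΔ32
  have hK' : ∀ x ∈ NonCoincident 3 2, |S' 2 x| ≤ C * max 1 (‖x 0 - x 1‖ ^ (-(max a 1))) := by
    intro x hx
    obtain ⟨h0, h1⟩ := hK x hx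
    rw [abs_of_nonneg h0]
    refine h1.trans (mul_le_mul_of_nonneg_left ?_ hC0)
    have hne : x 0 ≠ x 1 := fun h => by
      have := (mem_nonCoincident x).1 hx h
      exact absurd this (by decide)
    have ht : 0 < ‖x 0 - x 1‖ := norm_pos_iff.2 (sub_ne_zero.2 hne)
    rcases le_or_gt ‖x 0 - x 1‖ 1 with hle | hgt
    · exact max_le_max le_rfl
        (Real.rpow_le_rpow_of_exponent_ge ht hle (neg_le_neg (le_max_left a 1)))
    · have hsmall : ‖x 0 - x 1‖ ^ (-a) ≤ 1 :=
        Real.rpow_le_one_of_one_le_of_nonpos hgt.le (neg_nonpos.2 ha0)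
      rw [max_eq_left hsmall]
      exact le_max_left _ _
  -- 5. assemble
  refine ⟨ρ, Δ, S', L, μ, ⟨hρ, hΔ, hlim', hnorm', hnd', hE', hsc', hL, hlaw, ?_, ?_, ?_⟩,
    hμP, hasAllMoments_limitLaw hlim' hnd' hsc' hΔ hΔ32 hν hL hlawν,
    fun f => integrable_exp_eval_limitLaw hlim' hnd' hsc' hΔ hΔ32 hν hL hlawν f,
    fun n => fieldLimit_measurable_indicator_of_continuousOn (isOpen_nonCoincident 3 n)
      (RotationUpgradeFromTwoPointNegative.continuousOn_of_limit hlim n),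
    ⟨C, max a 1, lt_max_of_lt_right one_pos, max_lt ha3 (by norm_num), hK'⟩⟩
  · -- C10: moment densities
    intro n f
    rw [moment_limitLaw_eq hlim' hnd' hsc' hΔ hΔ32 hν hL hlawν f]
    exact integral_congr_ae (Eventually.of_forall fun x => mul_comm _ _)
  · -- C11: Euclidean invariance of the law
    exact fieldLimit_isEuclideanInvariantLaw_of hμC hE'
  · -- C12: scale covariance of the law
    intro s hs
    exact map_act_scale_eq_self hμC hsc' s hs

end Summit.CriticalPhenomena.Ising3DConformalLimit.Theorems

end
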